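import Summits.HodgeConjecture.HodgeConjecture.Theorems.Ring2AtlasOpenCells
import Literature.AlgebraicGeometry.HodgeTheory.WeilClassesSixfolds
import Literature.AlgebraicGeometry.HodgeTheory.WeilClassesSixfoldsSqrtMinus1Koike
import Literature.AlgebraicGeometry.HodgeTheory.WeilClassesSixfoldsSqrtMinus3Schoen
import Literature.AlgebraicGeometry.HodgeTheory.AlgebraicClassesCupAbelianVarietyDiagonal
import Literature.AlgebraicGeometry.HodgeTheory.AbelianVarietyPullbackAlgebraicClasses
import Literature.AlgebraicGeometry.HodgeTheory.AbelianLowDimensionWeilReductionProofs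
import Literature.AlgebraicGeometry.HodgeTheory.LefschetzOneOneHolds
import Literature.AlgebraicGeometry.Motives.AbelianVarietyProductDimProofs
import HarnessLib

/-!
# Ring 2 · AbelianAll (seat `ab-weil-2`) — the power cell of `E_k × Y₄(1,3)` from ONE Weil plane on the sixfold `E_k² × Y`

HONEST FRAMING (sub-cell `pub-hodge-ring2-ab-*`, verbatim): research route, not a corollary; conditional on HC_CM plus
one named minimal statement. (Cell `pub-hodge-ring2`, verbatim: research route conditional on HC_CM; not a corollary;
Q11.4-sentence-2 already refuted in dim ≥ 3.) `HC_CM` (:= `Theses.RankFourFaces.CMAbelianHodge`) occurs NOWHERE in this file.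

THE CELL. `Ring2.Atlas.HodgePowersOfEllipticTimesFourfold13` (atlas-1, `Theorems/Ring2AtlasOpenCells.lean`): HC for the powers
`X^{N+1}`, `N ≥ 1`, of `X = E × Y`, `E` an elliptic curve with CM by `k = ℚ(√-d)` (`φ ≫ φ = -d`), `Y` a SIMPLE fourfold with `ψ ≫ ψ = -d`
and `±i√d`-multiplicity `1` on `T₀Y` (Moonen–Zarhin 1999 case (g); sub-cases (g1) `End⁰(Y) = k`, (g2) `End⁰(Y)` quartic CM `∋ k`,
(g3) `Y` CM). Print status recorded by the atlas: OPEN ("nearest print: Markman 2025 Thm. 1.5.1, sixfolds of disc −1, UNREFEREED").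
Exceptional classes (atlas, certified): `X²` from degree 3 on, of dimension 10 / 18 / 32 in the three sub-cases; `X³`: 90 / 216 / 486.

WHAT THIS FILE PROVES (kernel, 0 sorry): the cell follows from
* ONE printed input on hyperbolic Weil SIXFOLDS — Markman, arXiv:2502.03415 Thm. 1.5.1 (tree named fact
  `HodgeTheory.Markman2025_weilClasses_algebraic_hyperbolicSixfold`, UNREFEREED; every `k`), or, for `k = ℚ(i)` resp. `ℚ(√-3)`, the
  REFEREED facts `Koike2004_weilClasses_algebraic_hyperbolicSixfold_one` (Koike 2004 Cor. 2.1) resp.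
  `Schoen1998_weilClasses_algebraic_hyperbolicSixfold_three` (Schoen 1988/1998) — binders, never asserted; and
* ONE typed hypothesis `EllipticTimesFourfold13WeilSeeded` (§2): for every member, the sixfold `Z = (E × E) × Y` carries a Weil
  structure `(φ_Z, d)` that is HYPERBOLIC for some `k`-symmetrised hyperplane class, and every rational `(p,p)`-class on every power
  `(E × Y)^{N+1}` lies in the `ℂ`-algebra generated by divisor monomials and the pull-backs `f^* w` of the rational `(3,3)` Weil classes
  `w ∈ weilClassesOf Z φ_Z 3 d` along homomorphisms `f : (E × Y)^{N+1} → Z` (the inductive predicate `InDivisorSeedAlgebra`, §1).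
  This is PROPOSITION R4 of `run/shared/lean/pub/pub-hodge-ring2/pub-hodge-ring2-ab-weil-2/WEIL-CELLS.md` — DERIVED by this seat
  (First Fundamental Theorem of invariant theory for `SL(V)` resp. `SL(V₁) × SL(V₂)` resp. the CM torus on the tensor algebra,
  projection to the exterior algebra, weights with respect to Moonen–Zarhin's one-character Hodge group
  `Hg(E × Y) = {(u₁,u₂) : u₁² · det_k(u₂) = 1}` [MZ99 §5 Case 2], regrouping into blocks `χχ · det V` = polarised pull-backs of the
  Weil class of `Z`; the hyperbolic polarisation on `Z` from `NS(E_k²)_ℚ ≅ Herm₂(k)`, `det M = ab` sweeping `ℚ_{>0}`); its level-one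
  dimension predictions `2·C(N+1,2)·∏ⱼ dim Sym^{dim Vⱼ}(ℂ^{N+1})` EQUAL the certified atlas numbers 10/18/32 (on `X²`) and 90/216/486
  (on `X³`). ABSOLUTE RULE: a cell-derived statement is a HYPOTHESIS (`hR4`), never a fact; referee SOUND pending.
ENGINE (§1, proved): every class in `InDivisorSeedAlgebra B m S` is algebraic as soon as the seeds are — Lefschetz (1,1)
(`lefschetzOneOne_rational_holds`) and divisor monomials (`AbelianVariety.divisorClassesSpan_le_algebraicClasses`), cup products of
algebraic classes on an abelian variety (`AbelianVariety.cupProduct_mem_algebraicClasses'`, Voisin II 9.20 / Fulton B.9.2), linearity.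
Seeds algebraic (§2): pull-back preserves algebraic classes (`map_mem_algebraicClasses_of_abelianVariety`, Kleiman moving) and the
sixfold fact on `(Z, φ_Z)`.

RESULTS: `hodgePowersOfEllipticTimesFourfold13_of_markmanSixfolds_of_weilSeeded (hM) (hR4) : Ring2.Atlas.HodgePowersOfEllipticTimesFourfold13`
(whole cell, every `k`, modulo the UNREFEREED sixfold fact); `hodgeConjectureFor_powSucc_ellipticTimesFourfold13_of_koike_of_weilSeeded`
(`d = 1`) and `…_of_schoen_of_weilSeeded` (`d = 3`) — the `k ∈ {ℚ(i), ℚ(√-3)}` sub-cells from REFEREED facts, all powers, all three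
sub-cases including the CM one (g3): there `X` is of CM type and HC of its powers is decided WITHOUT `HC_CM`.
Atlas wording (for atlas-1's renderer, never "closed in tree" while `hR4` is a hypothesis): rows g5.(g1)/(g2)/(g3), power column —
"KNOWN in refereed print for `k ∈ {ℚ(i), ℚ(√-3)}` and modulo [M25] 1.5.1 otherwise, both modulo DERIVED R4 (ab-weil-2)".

## References
* [MoonenZarhin1999LowDim] Math. Ann. 315 (1999) = arXiv:math/9901113, Thm. 0.2 (3) and §5 Case 2 (`Hg(E × Y)`, `W_k ⊂ H⁶(E² × Y)`).
* [Markman2025SecantWeil] arXiv:2502.03415, Thm. 1.5.1 (UNREFEREED). [Koike2004WeilHodge] Canad. Math. Bull. 47 (2004), Cor. 2.1.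
  [Schoen1988HodgeWeil] Compositio 65 (1988); [Schoen1998HodgeWeilAddendum].
* [vanGeemen1994HodgeAV] LNM 1594, 4.9, Lemma 5.2–5.4, Thm. 6.12. [VoisinHodgeII2003] Prop. 9.20. [Fulton1998] App. B.9.2.
* H. Weyl, The Classical Groups (FFT for `SL_n`) — used only in the docstring proof of R4.
-/

set_option linter.dupNamespace false

noncomputable section

open CategoryTheory

namespace Summit.HodgeConjecture.HodgeConjecture.Ring2.AbelianAll

open Literature.AlgebraicGeometry Literature.AlgebraicGeometry.Motives
open Literature.AlgebraicGeometry.HodgeTheory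
open Literature.AlgebraicTopology.SingularHomology
open Literature.Barriers.HodgeConjecture
open Summit.HodgeConjecture.HodgeConjecture.Theses

/-! ## §1 The divisor–seed algebra and its engine -/

/-- **The `ℂ`-algebra of even cohomology classes of an abelian variety `B` generated by divisor monomials and a set of SEED
classes `S` in degree `2m`**, as an inductive predicate on the graded pieces `H^{2p}(B(ℂ); ℂ)`: divisor monomials
(`divisorClassesSpan`, van Geemen's `Dᵖ ⊗ ℂ`, including the unit class in degree 0) and the seeds are in it, and it is closed under
`0`, `+`, scalars and cup products. For `S` = pull-backs of Weil classes this renders "the Hodge ring is generated by divisors and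
pull-backs of Weil classes" (Moonen–Zarhin 1999 Thm. 0.2 (1)–(2): "generated by … divisor classes together with the subspaces `W_{k,α}`").
A predicate; nothing asserted. [cite: MoonenZarhin1999LowDim, Thm. 0.2] [cite: vanGeemen1994HodgeAV, §2.4] -/
inductive InDivisorSeedAlgebra (B : AbelianVariety ℂ) (m : ℕ) (S : Set (complexBetti B.X (2 * m))) :
    ∀ p : ℕ, complexBetti B.X (2 * p) → Prop
  | seed {s : complexBetti B.X (2 * m)} (hs : s ∈ S) : InDivisorSeedAlgebra B m S m s
  | divisorSpan {p : ℕ} {c : complexBetti B.X (2 * p)} (hc : c ∈ divisorClassesSpan B.X B.dim p) :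
      InDivisorSeedAlgebra B m S p c
  | zero (p : ℕ) : InDivisorSeedAlgebra B m S p 0
  | add {p : ℕ} {x y : complexBetti B.X (2 * p)} :
      InDivisorSeedAlgebra B m S p x → InDivisorSeedAlgebra B m S p y → InDivisorSeedAlgebra B m S p (x + y)
  | smul {p : ℕ} (a : ℂ) {x : complexBetti B.X (2 * p)} :
      InDivisorSeedAlgebra B m S p x → InDivisorSeedAlgebra B m S p (a • x)
  | cup {l q p : ℕ} (h : 2 * l + 2 * q = 2 * p) {x : complexBetti B.X (2 * l)} {y : complexBetti B.X (2 * q)} :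
      InDivisorSeedAlgebra B m S l x → InDivisorSeedAlgebra B m S q y → InDivisorSeedAlgebra B m S p (cupProduct h x y)

/-- **ENGINE (proved): if the seeds are algebraic, every class of the divisor–seed algebra is algebraic** — Lefschetz (1,1) and
divisor monomials (`AbelianVariety.divisorClassesSpan_le_algebraicClasses` over `lefschetzOneOne_rational_holds`), cup products of
algebraic classes on an abelian variety (`AbelianVariety.cupProduct_mem_algebraicClasses'`), and linearity of `algebraicClasses`.
[cite: VoisinHodgeII2003, Prop. 9.20] [cite: vanGeemen1994HodgeAV, §2.4] -/
theorem mem_algebraicClasses_of_inDivisorSeedAlgebra {B : AbelianVariety ℂ} {m : ℕ} {S : Set (complexBetti B.X (2 * m))}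
    (hS : ∀ s ∈ S, s ∈ algebraicClasses B.X m) {p : ℕ} {c : complexBetti B.X (2 * p)}
    (h : InDivisorSeedAlgebra B m S p c) : c ∈ algebraicClasses B.X p := by
  induction h with
  | seed hs => exact hS _ hs
  | divisorSpan hc =>
    exact AbelianVariety.divisorClassesSpan_le_algebraicClasses B
      (fun b hb hb' ↦ lefschetzOneOne_rational_holds (AbelianVariety.isSmoothProjective_holds (A := B)) b hb hb') _ hc
  | zero p => exact Submodule.zero_mem _
  | add _ _ ihx ihy => exact Submodule.add_mem _ ihx ihy
  | smul a _ ih => exact Submodule.smul_mem _ a ih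
  | cup h _ _ ihx ihy => exact AbelianVariety.cupProduct_mem_algebraicClasses' B h ihx ihy

/-- With algebraic seeds, a variety all of whose rational `(p,p)`-classes lie in the divisor–seed algebra satisfies the Hodge
conjecture (summit-layer predicate `HodgeConjectureFor`). [cite: vanGeemen1994HodgeAV, §2.4] -/
theorem hodgeConjectureFor_of_inDivisorSeedAlgebra {B : AbelianVariety ℂ} {m : ℕ} {S : Set (complexBetti B.X (2 * m))}
    (hS : ∀ s ∈ S, s ∈ algebraicClasses B.X m)
    (hgen : ∀ (p : ℕ) (c : complexBetti B.X (2 * p)), IsRationalClass c → IsOfHodgeType B.dim B.X (2 * p) p p c →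
      InDivisorSeedAlgebra B m S p c) :
    HodgeConjectureFor B.dim B.X :=
  ⟨nonempty_hodgeModel_holds (AbelianVariety.isSmoothProjective_holds (A := B)),
    fun p c hc hpp ↦ mem_algebraicClasses_of_inDivisorSeedAlgebra hS (hgen p c hc hpp)⟩

/-! ## §2 Weil pull-back seeds from the sixfold `Z = (E × E) × Y`, the typed hypothesis R4, and the cell -/

/-- **The Weil pull-back seeds on `B` from a Weil structure `(φ_Z, d)` on `Z`**: the classes `f^* w ∈ H⁶(B(ℂ); ℂ)` with `f : B → Z` a
homomorphism and `w ∈ weilClassesOf Z φ_Z 3 d` a RATIONAL class of Hodge type `(3,3)` (van Geemen 4.9: the Weil plane is spanned by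
rational classes; for Weil type they are `(3,3)`). Moonen–Zarhin's "pull-backs of the Weil classes" / "the subspaces `W_{k,α}`".
[cite: MoonenZarhin1999LowDim, Thm. 0.2 (1) and §5 Case 2] [cite: vanGeemen1994HodgeAV, 4.9] -/
def weilPullbackSeeds (B Z : AbelianVariety ℂ) (φZ : Z ⟶ Z) (d : ℕ) : Set (complexBetti B.X (2 * 3)) :=
  {s | ∃ (f : B ⟶ Z) (w : complexBetti Z.X (2 * 3)), IsRationalClass w ∧ IsOfHodgeType (2 * 3) Z.X (2 * 3) 3 3 w ∧
      w ∈ weilClassesOf Z φZ 3 d ∧ s = complexBetti.map f.hom.hom.hom (2 * 3) w}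

/-- If the rational `(3,3)` Weil classes of `(Z, φ_Z, d)` are algebraic, so is every Weil pull-back seed (pull-back along a
homomorphism of abelian varieties preserves algebraic classes: `map_mem_algebraicClasses_of_abelianVariety`, Kleiman moving).
[cite: Fulton1998, App. B.9.2] -/
theorem weilPullbackSeeds_subset_algebraicClasses {B Z : AbelianVariety ℂ} {φZ : Z ⟶ Z} {d : ℕ}
    (hW : ∀ w : complexBetti Z.X (2 * 3), IsRationalClass w → IsOfHodgeType (2 * 3) Z.X (2 * 3) 3 3 w →
      w ∈ weilClassesOf Z φZ 3 d → w ∈ algebraicClasses Z.X 3) :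
    ∀ s ∈ weilPullbackSeeds B Z φZ d, s ∈ algebraicClasses B.X 3 := by
  rintro s ⟨f, w, hw, hww, hwW, rfl⟩
  exact map_mem_algebraicClasses_of_abelianVariety (AbelianVariety.isSmoothProjective_holds (A := B)) Z f.hom.hom.hom
    (hW w hw hww hwW)

/-- **TYPED HYPOTHESIS R4 (DERIVED by seat `ab-weil-2`; never a fact).** For every member `(E, Y, φ, ψ, d)` of the cell
`Ring2.Atlas.HodgePowersOfEllipticTimesFourfold13` the sixfold `Z = (E × E) × Y` carries an endomorphism `φ_Z` with `φ_Z ≫ φ_Z = -d`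
(in the derivation: `(±φ) × (±φ) × ψ`, the sign of `φ` on `E` chosen so that `φ`'s eigenvalue on `T₀E` is the multiplicity-ONE eigenvalue of `ψ` on
`T₀Y` — then `E²` contributes `(2,0)` to `ψ`'s `(1,3)` and `k` acts on `T₀Z` with multiplicities `(3,3)` (ref2 F-ref2-52) — Moonen–Zarhin:
"`Z := E² × Y` … `W_k ⊂ H⁶(Z,ℚ)` consists of Hodge classes" [corpus:paper:arxiv-math_9901113 p0010 L91–97]) which is HYPERBOLIC for some
`k`-symmetrised hyperplane class (`NS(E_k²)_ℚ ≅ Herm₂(k)`: `det H_Z ≡ ab · det H_Y`, `ab` free in `ℚ_{>0}`, `det H_Y < 0`), AND for every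
`N` every rational `(p,p)`-class on `(E × Y)^{N+1}` lies in the divisor–seed algebra of the Weil pull-back seeds from `(Z, φ_Z, d)` —
PROPOSITION R4 of WEIL-CELLS.md: `B•((E×Y)^{N+1}) = ℚ[D¹, f^*W_k(Z)]`, proved there from the First Fundamental Theorem for the
derived group of `Hg(E × Y) = {u₁² det_k u₂ = 1}` plus weight bookkeeping; level-one counts `10/18/32`, `90/216/486` = atlas.
[cite: MoonenZarhin1999LowDim, §5 Case 2 and Thm. 0.2 (3)] [cite: vanGeemen1994HodgeAV, Lemma 5.2 and 5.4]
[status: cell proposition (DERIVED, ab-weil-2 R4); refereed SOUND by re-derivation (REFEREE-AB.md R-05; REFEREE.md §43.2, with a third implementation of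
the level-±1 numbers 12/12); generation-rank certificate queued by atlas-1 (A1.39 (ii)); a HYPOTHESIS in the kernel] -/
@[conjecture] def EllipticTimesFourfold13WeilSeeded : Prop :=
  ∀ (E Y : AbelianVariety ℂ) (φ : E ⟶ E) (ψ : Y ⟶ Y) (d : ℕ), 0 < d → E.dim = 1 → Y.dim = 4 → Y.IsSimple →
    φ ≫ φ = -(d • 𝟙 E) → ψ ≫ ψ = -(d • 𝟙 Y) →
    (HodgeTheory.eigenMultiplicity Y ψ (Complex.I * (Real.sqrt d : ℂ)) = 1 ∨
      HodgeTheory.eigenMultiplicity Y ψ (-(Complex.I * (Real.sqrt d : ℂ))) = 1) →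
    ∃ (φZ : (E.prod E).prod Y ⟶ (E.prod E).prod Y) (e : ProjectiveEmbedding ((E.prod E).prod Y).X)
      (a : complexBetti (projectiveSpace e.n ℂ) 2),
      φZ ≫ φZ = -(d • 𝟙 ((E.prod E).prod Y)) ∧ IsRationalClass a ∧ a ≠ 0 ∧
      IsHyperbolicWeilType ((E.prod E).prod Y) φZ 3
        ((d : ℂ) • complexBetti.map e.ι 2 a + complexBetti.map φZ.hom.hom.hom 2 (complexBetti.map e.ι 2 a)) ∧
      ∀ (N p : ℕ) (c : complexBetti ((E.prod Y).powSucc N).X (2 * p)), IsRationalClass c →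
        IsOfHodgeType ((E.prod Y).powSucc N).dim ((E.prod Y).powSucc N).X (2 * p) p p c →
        InDivisorSeedAlgebra ((E.prod Y).powSucc N) 3
          (weilPullbackSeeds ((E.prod Y).powSucc N) ((E.prod E).prod Y) φZ d) p c

/-- The dimension of the seed sixfold: `dim ((E × E) × Y) = 2 · 3` for `dim E = 1`, `dim Y = 4`. [folklore] -/
theorem dim_prod_prod_eq_six {E Y : AbelianVariety ℂ} (hE : E.dim = 1) (hY : Y.dim = 4) :
    ((E.prod E).prod Y).dim = 2 * 3 := by
  rw [AbelianVariety.dim_prod, AbelianVariety.dim_prod, hE, hY]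

/-- **The cell from ONE hyperbolic-sixfold input and R4 (generic form).** If the rational `(3,3)` Weil classes of every HYPERBOLIC
Weil sixfold `(Z, φ_Z)` with `φ_Z ≫ φ_Z = -d` are algebraic (the `d`-slice of Markman's Thm. 1.5.1 / Koike / Schoen, as a hypothesis
`hSix`), then R4 gives HC for every power of every member of the cell at that `d`. [cite: MoonenZarhin1999LowDim, §5 Case 2]
[cite: Markman2025SecantWeil, Thm. 1.5.1] -/
theorem hodgeConjectureFor_powSucc_ellipticTimesFourfold13_of_sixfoldSlice_of_weilSeeded {d : ℕ}
    (hSix : ∀ (Z : AbelianVariety ℂ) (φZ : Z ⟶ Z), Z.dim = 2 * 3 → IsSmoothProjective (2 * 3) Z.X →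
      φZ ≫ φZ = -(d • 𝟙 Z) → ∀ (e : ProjectiveEmbedding Z.X) (a : complexBetti (projectiveSpace e.n ℂ) 2),
      IsRationalClass a → a ≠ 0 →
      IsHyperbolicWeilType Z φZ 3 ((d : ℂ) • complexBetti.map e.ι 2 a + complexBetti.map φZ.hom.hom.hom 2 (complexBetti.map e.ι 2 a)) →
      ∀ c : complexBetti Z.X (2 * 3), IsRationalClass c → IsOfHodgeType (2 * 3) Z.X (2 * 3) 3 3 c →
        c ∈ weilClassesOf Z φZ 3 d → c ∈ algebraicClasses Z.X 3)
    (hR4 : EllipticTimesFourfold13WeilSeeded)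
    (E Y : AbelianVariety ℂ) (φ : E ⟶ E) (ψ : Y ⟶ Y) (hd : 0 < d) (hE : E.dim = 1) (hY : Y.dim = 4) (hYs : Y.IsSimple)
    (hφ : φ ≫ φ = -(d • 𝟙 E)) (hψ : ψ ≫ ψ = -(d • 𝟙 Y))
    (hm : HodgeTheory.eigenMultiplicity Y ψ (Complex.I * (Real.sqrt d : ℂ)) = 1 ∨
      HodgeTheory.eigenMultiplicity Y ψ (-(Complex.I * (Real.sqrt d : ℂ))) = 1)
    (N : ℕ) : HodgeConjectureFor ((E.prod Y).powSucc N).dim ((E.prod Y).powSucc N).X := by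
  obtain ⟨φZ, e, a, hφZ, ha, ha0, hyp, hgen⟩ := hR4 E Y φ ψ d hd hE hY hYs hφ hψ hm
  have hZ : ((E.prod E).prod Y).dim = 2 * 3 := dim_prod_prod_eq_six hE hY
  have hZsp : IsSmoothProjective (2 * 3) ((E.prod E).prod Y).X :=
    hZ ▸ AbelianVariety.isSmoothProjective_holds (A := (E.prod E).prod Y)
  exact hodgeConjectureFor_of_inDivisorSeedAlgebra
    (weilPullbackSeeds_subset_algebraicClasses (hSix _ φZ hZ hZsp hφZ e a ha ha0 hyp)) (hgen N)

/-- **THE CELL, every `k` (modulo Markman's UNREFEREED Thm. 1.5.1 and the typed R4).** `Ring2.Atlas.HodgePowersOfEllipticTimesFourfold13`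
from `Markman2025_weilClasses_algebraic_hyperbolicSixfold` (binder `hM`) and `EllipticTimesFourfold13WeilSeeded` (binder `hR4`);
`HC_CM` ABSENT. [cite: Markman2025SecantWeil, Thm. 1.5.1] [cite: MoonenZarhin1999LowDim, §5 Case 2] -/
theorem hodgePowersOfEllipticTimesFourfold13_of_markmanSixfolds_of_weilSeeded
    (hM : Markman2025_weilClasses_algebraic_hyperbolicSixfold) (hR4 : EllipticTimesFourfold13WeilSeeded) :
    Ring2.Atlas.HodgePowersOfEllipticTimesFourfold13 :=
  fun E Y φ ψ d hd hE hY hYs hφ hψ hm N _ ↦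
    hodgeConjectureFor_powSucc_ellipticTimesFourfold13_of_sixfoldSlice_of_weilSeeded (d := d)
      (fun Z φZ hZ hZsp hφZ e a ha ha0 hyp c hc hcc hcW ↦ hM d hd Z φZ hZ hZsp hφZ e a ha ha0 hyp c hc hcc hcW)
      hR4 E Y φ ψ hd hE hY hYs hφ hψ hm N

/-- **The `k = ℚ(i)` sub-cell from REFEREED print (Koike 2004, Cor. 2.1) and R4** — all powers of `E_i × Y`, all three sub-cases of
MZ99 case (g), including the CM one, WITHOUT `HC_CM`. [cite: Koike2004WeilHodge, Cor. 2.1] [cite: MoonenZarhin1999LowDim, §5 Case 2] -/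
theorem hodgeConjectureFor_powSucc_ellipticTimesFourfold13_of_koike_of_weilSeeded
    (hK : Koike2004_weilClasses_algebraic_hyperbolicSixfold_one) (hR4 : EllipticTimesFourfold13WeilSeeded)
    (E Y : AbelianVariety ℂ) (φ : E ⟶ E) (ψ : Y ⟶ Y) (hE : E.dim = 1) (hY : Y.dim = 4) (hYs : Y.IsSimple)
    (hφ : φ ≫ φ = -((1 : ℕ) • 𝟙 E)) (hψ : ψ ≫ ψ = -((1 : ℕ) • 𝟙 Y))
    (hm : HodgeTheory.eigenMultiplicity Y ψ (Complex.I * (Real.sqrt (1 : ℕ) : ℂ)) = 1 ∨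
      HodgeTheory.eigenMultiplicity Y ψ (-(Complex.I * (Real.sqrt (1 : ℕ) : ℂ))) = 1)
    (N : ℕ) : HodgeConjectureFor ((E.prod Y).powSucc N).dim ((E.prod Y).powSucc N).X :=
  hodgeConjectureFor_powSucc_ellipticTimesFourfold13_of_sixfoldSlice_of_weilSeeded (d := 1)
    (fun Z φZ hZ hZsp hφZ e a ha ha0 hyp c hc hcc hcW ↦ hK Z φZ hZ hZsp hφZ e a ha ha0 hyp c hc hcc hcW)
    hR4 E Y φ ψ one_pos hE hY hYs hφ hψ hm N

/-- **The `k = ℚ(√-3)` sub-cell from REFEREED print (Schoen) and R4** — all powers of `E_{√-3} × Y`, all three sub-cases, WITHOUT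
`HC_CM`. [cite: Schoen1998HodgeWeilAddendum] [cite: Schoen1988HodgeWeil] [cite: MoonenZarhin1999LowDim, §5 Case 2] -/
theorem hodgeConjectureFor_powSucc_ellipticTimesFourfold13_of_schoen_of_weilSeeded
    (hS : Schoen1998_weilClasses_algebraic_hyperbolicSixfold_three) (hR4 : EllipticTimesFourfold13WeilSeeded)
    (E Y : AbelianVariety ℂ) (φ : E ⟶ E) (ψ : Y ⟶ Y) (hE : E.dim = 1) (hY : Y.dim = 4) (hYs : Y.IsSimple)
    (hφ : φ ≫ φ = -((3 : ℕ) • 𝟙 E)) (hψ : ψ ≫ ψ = -((3 : ℕ) • 𝟙 Y))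
    (hm : HodgeTheory.eigenMultiplicity Y ψ (Complex.I * (Real.sqrt (3 : ℕ) : ℂ)) = 1 ∨
      HodgeTheory.eigenMultiplicity Y ψ (-(Complex.I * (Real.sqrt (3 : ℕ) : ℂ))) = 1)
    (N : ℕ) : HodgeConjectureFor ((E.prod Y).powSucc N).dim ((E.prod Y).powSucc N).X :=
  hodgeConjectureFor_powSucc_ellipticTimesFourfold13_of_sixfoldSlice_of_weilSeeded (d := 3)
    (fun Z φZ hZ hZsp hφZ e a ha ha0 hyp c hc hcc hcW ↦ hS Z φZ hZ hZsp hφZ e a ha ha0 hyp c hc hcc hcW)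
    hR4 E Y φ ψ (by norm_num) hE hY hYs hφ hψ hm N

/-- ON-PATH: under `HC_AV` every power of `E × Y` satisfies HC (so the file replaces `HC_AV` by `hM`/`hK`/`hS` + `hR4` on this cell; it is
not summit progress). [cite: Deligne2000, §1] -/
theorem hodgeConjectureFor_powSucc_prod_of_hodgeAbelianVarieties (h : PadicSemiregularLift.HodgeAbelianVarieties)
    (E Y : AbelianVariety ℂ) (N : ℕ) : HodgeConjectureFor ((E.prod Y).powSucc N).dim ((E.prod Y).powSucc N).X :=
  h ((E.prod Y).powSucc N)

end Summit.HodgeConjecture.HodgeConjecture.Ring2.AbelianAll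

end
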